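import Literature.NumberTheory.EllipticCurves.CongruenceVisibilityLocalFactors
import Literature.NumberTheory.EllipticCurves.CongruentNumberCurveSupersingular
import Literature.NumberTheory.EllipticCurves.TorsionFrobeniusProofs
import HarnessLib

/-!
# The visibility count with an INDEX CERTIFICATE and ONE costly place — `Ш(E)[3] ≠ 0` in the
# `hvis` currency (team n1011, row T-DIV3L, FILE D13)

HONEST FRAMING (cell `b2b-bsdres`, run/shared/lean/b2b/bsd-rank1-residual/, verbatim in every
file): the goal of the cell is to DELETE the COMBINATION-SHAPED residual classes of the
Birch–Swinnerton-Dyer formula for ALL analytic-rank `≤ 1` elliptic curves over `ℚ` — "full BSD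
formula for every rank `≤ 1` curve in class `C`" assembled STRICTLY from published theorems — so
that the rank-`≤ 1` remainder becomes exactly the CONSTRUCTION-SHAPED classes, which are TYPED
(missing-input `Prop`s), NOT attempted. This is not "finishing BSD". Team n1011 (N10/N11): research
route; this file is a TOOL (the Cremona–Mazur / Agashe–Stein dimension count of the tree with its
rank input replaced by a displayed INDEX bound); nothing is booked by it; no mark / label moved; X4
stays CONSTRUCTION-SHAPED. THEOREMS only; no definition, no named fact, no `sorry`.

## What

The tree's count `WeierstrassCurve.exists_sha_ne_zero_of_congr` (Literature
`CongruenceVisibilityLocalFactors`) concludes `Ш(E/ℚ)[3] ≠ 0` from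
`[E(ℚ):3E(ℚ)] · ∏_{v ∈ S} #E′(ℚ_v)[3] · 3 < [E′(ℚ):3E′(ℚ)]`. n1011-p03's / p18's ENDs feed the
right side from `hrank : 2 ≤ rank E′(ℚ)`; FILES D7/D11 certify `9 ≤` / `27 ≤ [E′(ℚ):3E′(ℚ)]` in the
kernel instead. This file states the count with

* the index bound DISPLAYED: `hidx : m ≤ [E′(ℚ):3E′(ℚ)]` (in the classical `DecidableEq ℚ`
  currency of the tree's theorem — D7's `…_inst` / D11's END deliver exactly this with
  `d := fun a b => Classical.propDecidable (a = b)`),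
* `E(ℚ)` finite of order prime to `3` (`[E(ℚ):3E(ℚ)] = 1`),
* ONE costly place `v₀ ∈ S` with `#E′(ℚ_{v₀})[3] ≤ t` and `#E′(ℚ_v)[3] = 1` at the other places of
  `S`, and the budget inequality `t · 3 < m` (`t = 1`: `3 < 9`; `t = 3`: `9 < 27`),

in the `hvis` currency `∃ c : Ш(E/ℚ), c ≠ 0 ∧ 3 • c = 0` consumed by n1011-p14's kind-agnostic ENDs
`X4RankZero.bsdp_three_potMult_of_exists_sha_three_torsion` / `…_of_exists_sha_torsion_of_kato`
(`Additive/X4RankZeroVisibleLowerBoundPlacesSix`). ENDs: `exists_sha_three_torsion_of_congr_of_index`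
(finite set `S`) and `…_of_primeList` (`S` = the places over a prime list `L ∋ 3` supporting both
discriminants, p18's (T) construction; the costly place named by its prime `q₀ ∈ L`). Targets
(EVIDENCE): r1's 27 PASS-rank3 rows and p18's 12 FAIL-rank rank-3 rows (one paid place, `27 ≤ index`
by D11: census `gen9/census/idx27_certs.json` 305/305), and every PASS-places row (`t = 1`, D7).

References: [CremonaMazur2000] §3; [AgasheStein2002] Lemma 3.6, Thm. 3.1; [MilneADT2006] I.3.3;
[SilvermanAEC2009] VII.5.1(a), VIII.1.
-/

set_option autoImplicit false

noncomputable section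

open scoped Classical

open WeierstrassCurve NumberField IsDedekindDomain Rat.HeightOneSpectrum Field
  Literature.NumberTheory.EllipticCurves Literature.NumberTheory.GaloisRepresentations

namespace Summit.BirchSwinnertonDyer.Rank1Residual.GaloisImage.DivisionDecider

/-- **The dimension count with a displayed index bound and one costly place.** `θ : E′[3] ⥲ E[3]`
`Γ_ℚ`-equivariant; `S` a finite set of places outside which both curves are good and `v ∤ 3`;
`E(ℚ)` finite of order prime to `3`; `v₀ ∈ S` with `#E′(ℚ_{v₀})[3] ≤ t`, `#E′(ℚ_v)[3] = 1` for the
other `v ∈ S`; `t · 3 < m ≤ [E′(ℚ):3E′(ℚ)]` (the index in the classical `DecidableEq ℚ` currency of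
the tree's count theorem). Then `Ш(E/ℚ)[3]` has a non-zero element.
[cite: CremonaMazur2000, §3 pp. 19–22] [cite: AgasheStein2002, Lemma 3.6 and Thm. 3.1]
[cite: MilneADT2006, I Lemma 3.3] -/
theorem exists_sha_three_torsion_of_congr_of_index (W W' : WeierstrassCurve ℚ) [W.IsElliptic]
    [W'.IsElliptic] (θ : geomTorsion W' ((3 : ℕ) : ℤ) ≃+ geomTorsion W ((3 : ℕ) : ℤ))
    (hθ : ∀ (σ : Field.absoluteGaloisGroup ℚ) (P : geomTorsion W' ((3 : ℕ) : ℤ)),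
      θ (σ • P) = σ • θ P)
    (S : Finset (HeightOneSpectrum (𝓞 ℚ)))
    (hS : ∀ v : HeightOneSpectrum (𝓞 ℚ), v ∉ S →
      W.HasGoodReductionAt v ∧ W'.HasGoodReductionAt v ∧ ((3 : ℕ) : 𝓞 ℚ) ∉ v.asIdeal)
    (hfin : Finite W.toAffine.Point) (hcop : (Nat.card W.toAffine.Point).Coprime 3)
    {v₀ : HeightOneSpectrum (𝓞 ℚ)} (hv₀ : v₀ ∈ S) {t : ℕ}
    (ht : Nat.card (nsmulAddMonoidHom 3 :
      (W'.baseChange (v₀.adicCompletion ℚ)).toAffine.Point →+ _).ker ≤ t)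
    (hloc : ∀ v ∈ S, v ≠ v₀ → Nat.card (nsmulAddMonoidHom 3 :
      (W'.baseChange (v.adicCompletion ℚ)).toAffine.Point →+ _).ker = 1)
    {m : ℕ} (htm : t * 3 < m)
    (hidx : m ≤ (letI : DecidableEq ℚ := fun a b => Classical.propDecidable (a = b)
      (zsmulAddGroupHom ((3 : ℕ) : ℤ) : W'.toAffine.Point →+ W'.toAffine.Point).range.index)) :
    ∃ c : W.sha, c ≠ 0 ∧ (3 : ℕ) • c = 0 := by
  haveI : Fact (Nat.Prime 3) := ⟨Nat.prime_three⟩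
  -- the tree's count theorem carries the CLASSICAL `DecidableEq ℚ` on `E(ℚ)`: make it the local
  -- instance so every index term below is in that currency (instance bookkeeping, no content)
  letI : DecidableEq ℚ := fun a b => Classical.propDecidable (a = b)
  haveI : Finite W.toAffine.Point := hfin
  have hprod : ∏ v ∈ S, Nat.card (nsmulAddMonoidHom 3 :
      (W'.baseChange (v.adicCompletion ℚ)).toAffine.Point →+ _).ker =
      Nat.card (nsmulAddMonoidHom 3 :
        (W'.baseChange (v₀.adicCompletion ℚ)).toAffine.Point →+ _).ker :=
    Finset.prod_eq_single_of_mem v₀ hv₀ fun v hv hne => hloc v hv hne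
  have hvis : ∃ c : W.sha, c ≠ 0 ∧ 3 • c = 0 := by
    refine W.exists_sha_ne_zero_of_congr W' (by norm_num) θ hθ S hS ?_
    rw [index_range_zsmul_eq_one_of_coprime hcop, one_mul, hprod, Module.finrank_self, pow_one]
    calc Nat.card (nsmulAddMonoidHom 3 :
            (W'.baseChange (v₀.adicCompletion ℚ)).toAffine.Point →+ _).ker * 3
        ≤ t * 3 := Nat.mul_le_mul_right 3 ht
      _ < m := htm
      _ ≤ _ := hidx
  simpa using hvis

/-- **Prime-list form** (p18's (T) construction): `S` = the places over a list of rational primes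
`L ∋ 3` supporting the discriminants of integer models `E₀`, `F₀` of `E`, `E′` (outside: both good,
`v ∤ 3`, Silverman VII.5.1(a)); the costly place is the place of `q₀ ∈ L`; local inputs asked per
prime of `L` (`= 1` away from `q₀`, `≤ t` at `q₀` — T-LOC3L certificates BY NAME); `t · 3 < m ≤ index`
(D7 / D11 certificate). Output in the `hvis` currency. [cite: SilvermanAEC2009, VII.5 Prop. 5.1(a)]
[cite: CremonaMazur2000, §3 pp. 19–22] [cite: AgasheStein2002, Lemma 3.6 and Thm. 3.1] -/
theorem exists_sha_three_torsion_of_congr_of_index_of_primeList (W W' : WeierstrassCurve ℚ)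
    [W.IsElliptic] [W'.IsElliptic]
    (θ : geomTorsion W' ((3 : ℕ) : ℤ) ≃+ geomTorsion W ((3 : ℕ) : ℤ))
    (hθ : ∀ (σ : Field.absoluteGaloisGroup ℚ) (P : geomTorsion W' ((3 : ℕ) : ℤ)),
      θ (σ • P) = σ • θ P)
    (hfin : Finite W.toAffine.Point) (hcop : (Nat.card W.toAffine.Point).Coprime 3)
    {E₀ F₀ : WeierstrassCurve ℤ} (hE : E₀.map (Int.castRingHom ℚ) = W)
    (hF : F₀.map (Int.castRingHom ℚ) = W') (L : List ℕ) (h3L : 3 ∈ L)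
    (hΔE : ∀ q : ℕ, q.Prime → (q : ℤ) ∣ E₀.Δ → q ∈ L)
    (hΔF : ∀ q : ℕ, q.Prime → (q : ℤ) ∣ F₀.Δ → q ∈ L)
    {q₀ : ℕ} (hq₀ : q₀.Prime) (hq₀L : q₀ ∈ L) {t : ℕ}
    (ht : ∀ v : HeightOneSpectrum (𝓞 ℚ), (primesEquiv v : ℕ) = q₀ →
      Nat.card (nsmulAddMonoidHom 3 :
        (W'.baseChange (v.adicCompletion ℚ)).toAffine.Point →+ _).ker ≤ t)
    (hloc : ∀ v : HeightOneSpectrum (𝓞 ℚ), (primesEquiv v : ℕ) ∈ L → (primesEquiv v : ℕ) ≠ q₀ →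
      Nat.card (nsmulAddMonoidHom 3 :
        (W'.baseChange (v.adicCompletion ℚ)).toAffine.Point →+ _).ker = 1)
    {m : ℕ} (htm : t * 3 < m)
    (hidx : m ≤ (letI : DecidableEq ℚ := fun a b => Classical.propDecidable (a = b)
      (zsmulAddGroupHom ((3 : ℕ) : ℤ) : W'.toAffine.Point →+ W'.toAffine.Point).range.index)) :
    ∃ c : W.sha, c ≠ 0 ∧ (3 : ℕ) • c = 0 := by
  set e := primesEquiv (R := 𝓞 ℚ) with he
  -- the finite set of places over `L` (p18's construction, token for token)
  set S : Finset (HeightOneSpectrum (𝓞 ℚ)) :=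
    (L.filterMap fun q ↦ if h : q.Prime then some (e.symm ⟨q, h⟩) else none).toFinset with hSdef
  have hmemS : ∀ v : HeightOneSpectrum (𝓞 ℚ), v ∈ S ↔ (e v : ℕ) ∈ L := by
    intro v
    rw [hSdef, List.mem_toFinset, List.mem_filterMap]
    constructor
    · rintro ⟨q, hq, hqv⟩
      by_cases hqp : q.Prime
      · rw [dif_pos hqp, Option.some.injEq] at hqv
        rw [← hqv, Equiv.apply_symm_apply]
        exact hq
      · rw [dif_neg hqp] at hqv
        exact absurd hqv (by simp)
    · intro hv
      refine ⟨(e v : ℕ), hv, ?_⟩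
      rw [dif_pos (e v).2]
      simp
  -- the costly place
  set v₀ : HeightOneSpectrum (𝓞 ℚ) := e.symm ⟨q₀, hq₀⟩ with hv₀def
  have hev₀ : (e v₀ : ℕ) = q₀ := by rw [hv₀def, Equiv.apply_symm_apply]
  have hv₀S : v₀ ∈ S := (hmemS v₀).mpr (hev₀ ▸ hq₀L)
  refine exists_sha_three_torsion_of_congr_of_index W W' θ hθ S (fun v hvS ↦ ?_) hfin hcop hv₀S
    (ht v₀ hev₀) (fun v hvS hne ↦ hloc v ((hmemS v).mp hvS) fun h ↦ hne ?_) htm hidx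
  · have hvL : (e v : ℕ) ∉ L := fun h ↦ hvS ((hmemS v).mpr h)
    have hqp : (e v : ℕ).Prime := (e v).2
    refine ⟨?_, ?_, fun h3v ↦ hvL ?_⟩
    · rw [← hE]
      exact hasGoodReductionAt_map_of_not_dvd E₀ v fun h ↦ hvL (hΔE _ hqp h)
    · rw [← hF]
      exact hasGoodReductionAt_map_of_not_dvd F₀ v fun h ↦ hvL (hΔF _ hqp h)
    · rw [he, primesEquiv_eq_of_natCast_mem Nat.prime_three h3v]
      exact h3L
  · -- `e v = q₀ = e v₀` forces `v = v₀`
    apply e.injective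
    exact Subtype.ext (by rw [hev₀]; exact h)

end Summit.BirchSwinnertonDyer.Rank1Residual.GaloisImage.DivisionDecider

end
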